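import Literature.AlgebraicGeometry.Modules.RankOneModuleDivisorDictionary
import Literature.AlgebraicGeometry.Modules.DetClassOfIso
import Literature.AlgebraicGeometry.Modules.LineBundleOfCocycleClass
import Literature.AlgebraicGeometry.AbelianVarieties.SemiHomogeneousVectorBundle
import Literature.AlgebraicGeometry.Motives.AbelianVarietyWeilPairingRadical
import HarnessLib

/-!
# Rank-one modules are `𝒪_X(D)`; homogeneous line bundles on an abelian variety are the
# translation-invariant divisor classes (Hartshorne II Prop. 6.15; Mumford §8; Mukai 1978 Def. 4.4)

Layers `Literature/AlgebraicGeometry/Modules` (§1) and `Literature/AlgebraicGeometry/AbelianVarieties`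
(§2); namespaces `Literature.AlgebraicGeometry.Modules` and `Literature.AlgebraicGeometry.AbelianVarieties`.
THEOREMS ONLY (no definition, no named fact, no instance). The junction between the MODULE currency of
Mukai's `IsHomogeneous A E` (`AbelianVarieties/SemiHomogeneousVectorBundle`: `t_P^*E ≅ E` for every
rational point `P`) and the DIVISOR currency of the tree's `AbelianVariety.KTheta`
(`Motives/AbelianVarietyWeilPairingRadical`: `K(D) = {P ; t_P^*D ∼ D}`), through
`Ȟ¹(X, 𝒪_X^×)` (`Modules/RankOneModuleDivisorDictionary`, `Modules/DetClassOfIso`):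

* §1 on an integral scheme `X`: `detClass_lineBundle_toUnitCocycle` (`[det 𝒪_X(D)] = [𝒪_X(D)]`),
  `exists_iso_lineBundle_toUnitCocycle` (**every rank-one module is `≅ 𝒪_X(D)`** for a Cartier
  divisor `D`, Hartshorne II Prop. 6.15 — `D` is the divisor of the determinant cocycle),
  `detClass_eq_cechClass_of_iso`;
* §2 on an abelian variety `A` over a field `K`: `isHomogeneous_iff_of_iso`,
  `isHomogeneous_iff_forall_pullback_detClass_eq` (rank one: `t_P^*E ≅ E ⟺ t_P^*[E] = [E]`),
  **`isHomogeneous_lineBundle_iff_forall_linEquiv`** (`𝒪_A(D)` is homogeneous iff `t_P^*D ∼ D` for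
  all `P ∈ A(K)` — Mumford's definition of `Pic⁰`, §8), `isHomogeneous_lineBundle_iff_KTheta_eq_top`
  (iff `K(D) = A(K)`), `isHomogeneous_iff_forall_linEquiv_of_iso` and
  `isHomogeneous_iff_exists_iso_lineBundle` (a rank-one module is homogeneous iff it is `𝒪_A(D)` with
  `K(D) = A(K)`).

## References

* R. Hartshorne, *Algebraic Geometry* (1977), II Prop. 6.15, III Ex. 4.5. [Hartshorne1977]
* D. Mumford, *Abelian Varieties* (1970), §8 (`Pic⁰`: the classes with `T_x^*L ≅ L` for all `x`).
  [MumfordAV1970]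
* S. Mukai, *Semi-homogeneous vector bundles on an abelian variety*, J. Math. Kyoto Univ. 18
  (1978), Def. 4.4 (homogeneous vector bundles). [Mukai1978]
-/

noncomputable section

open CategoryTheory AlgebraicGeometry Opposite TopologicalSpace

universe u

/-! ### §1 Every rank-one module on an integral scheme is `𝒪_X(D)` -/

namespace Literature.AlgebraicGeometry.Modules

open Literature.AlgebraicGeometry.Motives

variable {X : Scheme.{u}} [IsIntegral X] {E : X.Modules}


/-- **The determinant class of `𝒪_X(D)`** (the glued line bundle of the cocycle of a Cartier
divisor) **is `[𝒪_X(D)]`**. [cite: GortzWedhorn2020, Prop. 11.21 (p. 374)] -/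
theorem detClass_lineBundle_toUnitCocycle (D : CartierDivisor X) :
    detClass D.toUnitCocycle.isFiniteLocallyFree_lineBundle = D.cechClass := by
  rw [D.toUnitCocycle.detClass_lineBundle, CartierDivisor.cechClass_eq_mk]

/-- **Every rank-one module on an integral scheme is `𝒪_X(D)` for a Cartier divisor `D`**
(Hartshorne II Prop. 6.15: "if `X` is integral, the homomorphism `CaCl X → Pic X` is an
isomorphism"; `D` = the divisor of the determinant cocycle). [cite: Hartshorne1977, II Prop. 6.15]
[cite: GortzWedhorn2020, Prop. 11.21 (p. 374)] -/
theorem exists_iso_lineBundle_toUnitCocycle (h₁ : HasRank E 1) :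
    ∃ D : CartierDivisor X, Nonempty (E ≅ (lineBundle D.toUnitCocycle)) := by
  obtain ⟨F, hF⟩ := exists_frameSystem_of_hasRank h₁
  refine ⟨F.cocycle.toCartierDivisor, nonempty_iso_of_cocycle_equiv F
    (F.cocycle.toCartierDivisor.toUnitCocycle.lineBundleFrameSystem) hF (fun _ => rfl) ?_⟩
  rw [UnitCocycle.mk_lineBundleFrameSystem_cocycle, ← CartierDivisor.cechClass_eq_mk,
    UnitCocycle.cechClass_toCartierDivisor]

/-- The determinant class of a rank-one module `E ≅ 𝒪_X(D)` is `[𝒪_X(D)]`. [cite: Hartshorne1977, II Prop. 6.15 and III Ex. 4.5] -/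
theorem detClass_eq_cechClass_of_iso {D : CartierDivisor X} (φ : E ≅ (lineBundle D.toUnitCocycle))
    (hE : IsFiniteLocallyFree E) : detClass hE = D.cechClass := by
  rw [detClass_eq_of_iso φ hE D.toUnitCocycle.isFiniteLocallyFree_lineBundle,
    detClass_lineBundle_toUnitCocycle]

end Literature.AlgebraicGeometry.Modules

/-! ### §2 Homogeneous line bundles on an abelian variety = translation-invariant divisor classes -/


namespace Literature.AlgebraicGeometry.AbelianVarieties

open Literature.AlgebraicGeometry.Motives Literature.AlgebraicGeometry.Modules

variable {K : Type u} [Field K] (A : AbelianVariety K)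

/-- Homogeneity is invariant under isomorphism of modules (Mukai's notion is a property of the
isomorphism class: transport `t_P^*E ≅ E` along `t_P^*φ` and `φ`). [cite: Mukai1978, Def. 4.4 (p. 253)] -/
theorem isHomogeneous_iff_of_iso {E E' : A.X.left.Modules} (φ : E ≅ E') :
    IsHomogeneous A E ↔ IsHomogeneous A E' := by
  refine ⟨fun h P => ?_, fun h P => ?_⟩
  · obtain ⟨e⟩ := h P
    exact ⟨((Scheme.Modules.pullback (A.translation P).left).mapIso φ).symm ≪≫ e ≪≫ φ⟩
  · obtain ⟨e⟩ := h P
    exact ⟨(Scheme.Modules.pullback (A.translation P).left).mapIso φ ≪≫ e ≪≫ φ.symm⟩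

/-- **A rank-one module is homogeneous iff its determinant class is translation invariant**:
`t_P^*E ≅ E` for all `P ∈ A(K)` iff `t_P^*[det E] = [det E]` for all `P`. [cite: Mukai1978, Def. 4.4 (p. 253)] -/
theorem isHomogeneous_iff_forall_pullback_detClass_eq {E : A.X.left.Modules} (h₁ : HasRank E 1)
    (hE : IsFiniteLocallyFree E) :
    IsHomogeneous A E ↔ ∀ P : A.Points K,
      CechPic.pullback (A.translation P).left (detClass hE) = detClass hE := by
  refine forall_congr' fun P => ?_
  rw [nonempty_iso_iff_detClass_eq (hasRank_pullback _ h₁) h₁ (hE.pullback _) hE, detClass_pullback]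

/-- **The line bundle `𝒪_A(D)` is homogeneous iff `t_P^*D ∼ D` for every rational point `P`**
(Mukai 1978, Def. 4.4 in rank one; Mumford, *Abelian Varieties* §8: the translation-invariant
classes `Pic⁰`). [cite: Mukai1978, Def. 4.4 (p. 253)] [cite: MumfordAV1970, §8 (definition of Pic⁰)] -/
theorem isHomogeneous_lineBundle_iff_forall_linEquiv (D : CartierDivisor A.X.left) :
    IsHomogeneous A (lineBundle D.toUnitCocycle) ↔
      ∀ P : A.Points K, (D.pullback (A.translation P).left).LinEquiv D := by
  rw [isHomogeneous_iff_forall_pullback_detClass_eq A D.toUnitCocycle.hasRank_lineBundle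
    D.toUnitCocycle.isFiniteLocallyFree_lineBundle]
  refine forall_congr' fun P => ?_
  rw [detClass_lineBundle_toUnitCocycle, ← CartierDivisor.cechClass_pullback,
    CartierDivisor.cechClass_eq_iff_linEquiv]

/-- The same with the tree's `K(D) = {P ; t_P^*D ∼ D}` (`AbelianVariety.KTheta`): **`𝒪_A(D)` is
homogeneous iff `K(D) = A(K)`**. [cite: MumfordAV1970, §8 (definition of Pic⁰)] -/
theorem isHomogeneous_lineBundle_iff_KTheta_eq_top (D : CartierDivisor A.X.left) :
    IsHomogeneous A (lineBundle D.toUnitCocycle) ↔ A.KTheta D = ⊤ := by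
  rw [isHomogeneous_lineBundle_iff_forall_linEquiv, Subgroup.eq_top_iff']
  exact forall_congr' fun P => (A.mem_KTheta_iff' D P).symm

/-- **A rank-one module `E ≅ 𝒪_A(D)` is homogeneous iff `t_P^*D ∼ D` for every rational point
`P`** (the module form of Mumford's `Pic⁰` condition, through the dictionary of §4).
[cite: Mukai1978, Def. 4.4 (p. 253)] [cite: MumfordAV1970, §8 (definition of Pic⁰)] -/
theorem isHomogeneous_iff_forall_linEquiv_of_iso {E : A.X.left.Modules} {D : CartierDivisor A.X.left}
    (φ : E ≅ (lineBundle D.toUnitCocycle)) :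
    IsHomogeneous A E ↔ ∀ P : A.Points K, (D.pullback (A.translation P).left).LinEquiv D := by
  rw [isHomogeneous_iff_of_iso A φ, isHomogeneous_lineBundle_iff_forall_linEquiv]

/-- **Every homogeneous rank-one module is `𝒪_A(D)` with `K(D) = A(K)`**, and conversely.
[cite: MumfordAV1970, §8 (definition of Pic⁰)] -/
theorem isHomogeneous_iff_exists_iso_lineBundle {E : A.X.left.Modules} (h₁ : HasRank E 1) :
    IsHomogeneous A E ↔
      ∃ D : CartierDivisor A.X.left, A.KTheta D = ⊤ ∧ Nonempty (E ≅ (lineBundle D.toUnitCocycle)) := by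
  obtain ⟨D, ⟨φ⟩⟩ := exists_iso_lineBundle_toUnitCocycle h₁
  rw [isHomogeneous_iff_of_iso A φ, isHomogeneous_lineBundle_iff_KTheta_eq_top]
  refine ⟨fun h => ⟨D, h, ⟨φ⟩⟩, fun ⟨D', hD', ⟨φ'⟩⟩ => ?_⟩
  rw [← isHomogeneous_lineBundle_iff_KTheta_eq_top, isHomogeneous_iff_of_iso A (φ.symm ≪≫ φ'),
    isHomogeneous_lineBundle_iff_KTheta_eq_top]
  exact hD'

end Literature.AlgebraicGeometry.AbelianVarieties

end
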